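import Mathlib
import HarnessLib
import Summits.AtomisticToContinuum.Crystallization.Statement
import Summits.AtomisticToContinuum.Crystallization.Theses.HolmgrenBoyleLind
import Summits.AtomisticToContinuum.Crystallization.Theorems.HolmgrenBoyleLindHalfSpaceRigidityPeriodic
import Summits.AtomisticToContinuum.Crystallization.Theorems.HolmgrenBoyleLindFLCEquilibriumPeriodic
import Summits.AtomisticToContinuum.Crystallization.Theorems.HolmgrenBoyleLindHullBalance
import Summits.AtomisticToContinuum.Crystallization.Theorems.HolmgrenBoyleLindUCContinuum
import Summits.AtomisticToContinuum.Crystallization.Theorems.HolmgrenBoyleLindHalfSpaceUniqueContinuationRungsOfCores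
import Literature.Analysis.Complex.DuffinSchaefferTheorem

/-!
# Skeleton for crux `HalfSpaceUniqueContinuation` (item stmt-AtomisticToContinuum-6075), line
`shell-locking` (strategist r1, 2026-08-17) — LEADING-SHELL LOCKING OF DEEP REGISTRIES: the thin-column
world of the layered core reduces to the thick-column world

The crux UC is, per FLC Delone Lennard-Jones equilibrium `Λ ⊂ ℝ³`, equivalent to "`Λ` is fully
periodic" (`flcEquilibriumPeriodic_iff_uc`, landed), and the period-rank ladder
`stub_rungsOfCores : core₀ → core₁ → core₂ → FLCEquilibriumPeriodic` is landed (p144051). The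
registered line `birth` (lead c3) cuts core₂ (two common horizontal periods `s, t ⊥ u`) as ONE stub
`stub_layeredOpenVanishing`; its recorded stuck goal is THIN COLUMNS (registry drift: no normal line
below the plane carries a divergent `∑ 1/depth` of observers) and, inside it, the invisible-defect
residual. This line re-cuts core₂ along a NEW lever and leaves core₀ / core₁ as the stubs shared with
`birth` (same statements; a proof closes them on both lines).

THE LEVER (leading-shell locking). Let `(ω, ω')` be a layered pair (both `δ`-separated, `r`-dense,
FLC, balanced, `s,t`-periodic, agreeing on `{⟪z,u⟫ < a}`) with signed defect `D = (ω ∖ ω') − (ω' ∖ ω)`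
(carried by `{⟪z,u⟫ ≥ a}`), and let `Φ = (Φ_u, Φ_c)` be its signed Lennard-Jones field, which vanishes
at every observer `x ∈ ω`, `⟪x,u⟫ < a` (`hbl_diffField_eq_zero_on_halfSpace`). In the landed mode
expansion (`hbl_signedField_hasSum_modes`, p169784) the HORIZONTAL components have no zero mode, and on
the first dual shell `|w_k| = ρ*` whose structure-factor Dirichlet series `S_k(l) = ∑_η ĉ_η(k) e^{-lη}`
do not all vanish identically, every mode profile has the SAME leading large-depth asymptotics
`const · S_k^{(j)}(2πρ*) · X^{-5/2-j} e^{-2πρ* X}` (Watson at the endpoint of the Bessel–Laplace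
kernel measure, p163412/p165799; `j` = least order with `(S_k^{(j)}(2πρ*))_k ≠ 0`), the horizontal
one carrying the extra factor `⟪c, w_k⟫`. Dividing the observer equations by the common scale:
along observers of depth `X_n → ∞` and registry `b_n ∈ W/L`,
`∑_{|w_k|=ρ*} y_k w_k e_k(b_n) → 0`, `y_k = S_k^{(j)}(2πρ*)`, i.e. EVERY ACCUMULATION POINT OF DEEP
REGISTRIES OF `ω` IS A CRITICAL POINT OF THE ONE-SHELL EIGENFUNCTION `T_y = ∑ y_k e_k` (`∇T_y = 2πi ∑ y_k w_k e_k`);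
once the zero mode is dead (Duffin–Schaeffer + `ae_eq_zero_of_laplace_exp_decay` + Dirichlet
uniqueness: every defect layer density-neutral) the vertical component adds `T_y(b_∞) = 0`: deep
registries are CRITICAL ZEROS of `T_y`. Critical zeros of a non-zero one-shell trigonometric
polynomial on a 2-torus are FINITE (the exponents lie on an ellipse, so every edge polynomial of the
Newton polygon is a binomial, hence square-free; a curve of common zeros of `P, z₁∂₁P, z₂∂₂P` would
force a square factor) — for EVERY layer lattice, generic or special. A finite accumulation set plus
FLC (finitely many registry steps, downward chains) gives EXACT CONFINEMENT: below some depth all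
registries of `ω` lie in a finite set — the hypothesis of the thick-column world
(`hbl_layered_eq_of_finite_registries`, c3, generic `L`). What is left of core₂ is the CONFINED pair
over the four special layer-lattice families (square / hexagonal / rectangular / centred-rectangular),
where the per-fibre shell equations from the thick classes leave exactly the point-group-antisymmetric
("Wyckoff twin") defect fibres — the full-force residual, now finite-dimensional per layer.

Registered stubs (7; lead c4 reshape 2026-08-17 of strategist r1's 5: `stub_shellLocking` is now the
sorry-free `shellLocking` composed from three registered stubs): `stub_ucRank0`, `stub_rodOpenVanishing`
(shared with `birth`), `stub_duffinSchaeffer` (the named classical fact `Boas1954_thm_10_5_1`, to be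
PROVED — the only analytic input of the zero-mode step off arithmetic progressions),
`stub_critFinite` (pure algebra: critical zeros of a non-zero one-shell trigonometric polynomial on
`W/L` are finite), `stub_lockingLimit` (the analytic lever, taking Duffin–Schaeffer and
`stub_critFinite` as hypotheses: a genuine defect confines the deep registries of `ω` asymptotically
to a finite set), `stub_confinement` (FLC + Delone combinatorics: asymptotic ⇒ exact confinement),
`stub_confinedRigidity` (confined layered pairs are rigid for every layer lattice: generic `L` is
c3's theorem with the plane lowered; special `L` is the Wyckoff-twin residual). Derived sorry-free:
`shellLocking`, `layeredRigidity`, `ucRank1` (as in `birth`), `ucRank2`, and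
`HalfSpaceUniqueContinuation_of` = converse glue ∘ ladder.
-/

namespace Summit.AtomisticToContinuum.Crystallization.Cruxes.HalfSpaceUniqueContinuation.ShellLocking

open scoped BigOperators Topology InnerProductSpace
open Literature.MathematicalPhysics.StatisticalMechanics
open Summit.AtomisticToContinuum.Crystallization.Theses.HolmgrenBoyleLind
open Summit.AtomisticToContinuum.Crystallization.Theorems
open Summit.AtomisticToContinuum.Crystallization.Theorems.HolmgrenBoyleLind

/-! ## The registered stubs -/

/-- **UC core, rank 0 (totally aperiodic `Λ`, every direction)** — shared with line `birth`. For a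
`δ`-separated, `r`-dense, FLC subset of `ℝ³` in exact Lennard-Jones force balance WITHOUT non-zero
periods, two patch-hull elements agreeing on an open half-space coincide. -/
theorem stub_ucRank0 :
    ∀ (Λ : Set (EuclideanSpace ℝ (Fin 3))) (δ r : ℝ), 0 < δ → 0 < r →
      (∀ x ∈ Λ, ∀ y ∈ Λ, x ≠ y → δ ≤ dist x y) →
      (∀ c : EuclideanSpace ℝ (Fin 3), ∃ y ∈ Λ, dist y c ≤ r) →
      (∀ R : ℝ, Set.Finite {S : Set (EuclideanSpace ℝ (Fin 3)) |
        ∃ x ∈ Λ, S = {v : EuclideanSpace ℝ (Fin 3) | x + v ∈ Λ ∧ ‖v‖ ≤ R}}) →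
      (∀ x ∈ Λ, HasSum (fun y : {y : EuclideanSpace ℝ (Fin 3) // y ∈ Λ ∧ y ≠ x} =>
        (deriv Literature.MathematicalPhysics.StatisticalMechanics.lennardJones
            (dist x (y : EuclideanSpace ℝ (Fin 3))) /
          dist x (y : EuclideanSpace ℝ (Fin 3))) • (x - (y : EuclideanSpace ℝ (Fin 3)))) 0) →
      (∀ t : EuclideanSpace ℝ (Fin 3), t ≠ 0 →
        ¬ (∀ x : EuclideanSpace ℝ (Fin 3), x + t ∈ Λ ↔ x ∈ Λ)) →
      ∀ ω ω' : Set (EuclideanSpace ℝ (Fin 3)),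
        (∀ R : ℝ, ∃ v : EuclideanSpace ℝ (Fin 3),
          {z : EuclideanSpace ℝ (Fin 3) | z ∈ ω ∧ ‖z‖ ≤ R} =
            {z : EuclideanSpace ℝ (Fin 3) | z + v ∈ Λ ∧ ‖z‖ ≤ R}) →
        (∀ R : ℝ, ∃ v : EuclideanSpace ℝ (Fin 3),
          {z : EuclideanSpace ℝ (Fin 3) | z ∈ ω' ∧ ‖z‖ ≤ R} =
            {z : EuclideanSpace ℝ (Fin 3) | z + v ∈ Λ ∧ ‖z‖ ≤ R}) →
        ∀ (u : EuclideanSpace ℝ (Fin 3)) (a : ℝ), u ≠ 0 →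
          (∀ z : EuclideanSpace ℝ (Fin 3), inner ℝ z u < a → (z ∈ ω ↔ z ∈ ω')) → ω = ω'  := by
  sorry

/-- **Rod open vanishing (rank-1 discrete-to-continuum front, pair form)** — shared with line
`birth`. Two `δ`-separated, `r`-dense, FLC subsets of `ℝ³` in exact Lennard-Jones force balance with
a common period `t ≠ 0`, agreeing on `{⟪z, u⟫ < a}` with `u ⊥ t`, have a signed difference field
vanishing on a non-empty open subset of that half-space. -/
theorem stub_rodOpenVanishing :
    ∀ (ω ω' : Set (EuclideanSpace ℝ (Fin 3))) (δ r : ℝ), 0 < δ → 0 < r →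
      (∀ x ∈ ω, ∀ y ∈ ω, x ≠ y → δ ≤ dist x y) →
      (∀ x ∈ ω', ∀ y ∈ ω', x ≠ y → δ ≤ dist x y) →
      (∀ c : EuclideanSpace ℝ (Fin 3), ∃ y ∈ ω, dist y c ≤ r) →
      (∀ c : EuclideanSpace ℝ (Fin 3), ∃ y ∈ ω', dist y c ≤ r) →
      (∀ R : ℝ, Set.Finite {S : Set (EuclideanSpace ℝ (Fin 3)) |
        ∃ x ∈ ω, S = {v : EuclideanSpace ℝ (Fin 3) | x + v ∈ ω ∧ ‖v‖ ≤ R}}) →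
      (∀ R : ℝ, Set.Finite {S : Set (EuclideanSpace ℝ (Fin 3)) |
        ∃ x ∈ ω', S = {v : EuclideanSpace ℝ (Fin 3) | x + v ∈ ω' ∧ ‖v‖ ≤ R}}) →
      (∀ x ∈ ω, HasSum (fun y : {y : EuclideanSpace ℝ (Fin 3) // y ∈ ω ∧ y ≠ x} =>
        (deriv Literature.MathematicalPhysics.StatisticalMechanics.lennardJones
            (dist x (y : EuclideanSpace ℝ (Fin 3))) /
          dist x (y : EuclideanSpace ℝ (Fin 3))) • (x - (y : EuclideanSpace ℝ (Fin 3)))) 0) →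
      (∀ x ∈ ω', HasSum (fun y : {y : EuclideanSpace ℝ (Fin 3) // y ∈ ω' ∧ y ≠ x} =>
        (deriv Literature.MathematicalPhysics.StatisticalMechanics.lennardJones
            (dist x (y : EuclideanSpace ℝ (Fin 3))) /
          dist x (y : EuclideanSpace ℝ (Fin 3))) • (x - (y : EuclideanSpace ℝ (Fin 3)))) 0) →
      ∀ t : EuclideanSpace ℝ (Fin 3), t ≠ 0 →
        (∀ x : EuclideanSpace ℝ (Fin 3), x + t ∈ ω ↔ x ∈ ω) → (∀ x : EuclideanSpace ℝ (Fin 3), x + t ∈ ω' ↔ x ∈ ω') →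
      ∀ (u : EuclideanSpace ℝ (Fin 3)) (a : ℝ), u ≠ 0 → inner ℝ t u = 0 →
      (∀ z : EuclideanSpace ℝ (Fin 3), inner ℝ z u < a → (z ∈ ω ↔ z ∈ ω')) →
      ∃ U₀ : Set (EuclideanSpace ℝ (Fin 3)), IsOpen U₀ ∧ U₀.Nonempty ∧ (∀ z ∈ U₀, inner ℝ z u < a) ∧
        ∀ z ∈ U₀,
          (∑' y : {y : EuclideanSpace ℝ (Fin 3) // y ∈ ω ∧ y ∉ ω'},
              (deriv Literature.MathematicalPhysics.StatisticalMechanics.lennardJones (dist z y) / dist z y) •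
                (z - (y : EuclideanSpace ℝ (Fin 3)))) -
            (∑' y : {y : EuclideanSpace ℝ (Fin 3) // y ∈ ω' ∧ y ∉ ω},
              (deriv Literature.MathematicalPhysics.StatisticalMechanics.lennardJones (dist z y) / dist z y) •
                (z - (y : EuclideanSpace ℝ (Fin 3)))) = 0 := by
  sorry

/-- **Duffin–Schaeffer (Boas, *Entire Functions*, Thm 10.5.1)** — the named classical fact, to be
PROVED (it grounds `Literature.Analysis.Complex.norm_le_exp_of_exp_decay_on_relDense`, LEMMA* of c2:
exponential smallness of a bounded holomorphic mode amplitude AT the observer depths — a real sequence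
with bounded gaps — upgrades to exponential decay on the half-plane). It is the only analytic input of
the zero-mode step of `stub_shellLocking` off arithmetic progressions of observers. -/
theorem stub_duffinSchaeffer : Literature.Analysis.Complex.Boas1954_thm_10_5_1 := by
  sorry

/-- **CRITICAL ZEROS OF A ONE-SHELL TRIGONOMETRIC POLYNOMIAL ARE FINITE (mod the period
lattice).** Let `s, t` span the layer lattice `L = ℤs + ℤt` of the horizontal plane `W = u^⊥`, let
`Y ⊂ W` be a finite set of dual vectors of ONE length `ρ` (`⟪w,s⟫, ⟪w,t⟫ ∈ ℤ`, `‖w‖ = ρ`), and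
`y : Y → ℂ` not identically zero. Then the set of `b ∈ W` with `T_y(b) = 0` and `∇T_y(b) = 0`,
`T_y(b) = ∑_{w∈Y} y_w e^{2πi⟪w,b⟫}` (so `∂_s T_y = 2πi ∑ y_w ⟪w,s⟫ e^{2πi⟪w,b⟫}`, `∂_t` likewise), is a
finite union of `L`-cosets. Proof route: in the coordinates `b = θ₁s + θ₂t`, `w = k₁s* + k₂t*`
(`k ∈ ℤ²` on the ELLIPSE `‖k₁s* + k₂t*‖ = ρ`), `T_y = P(z₁,z₂)` is a Laurent polynomial with
exponents in strictly convex position and the conditions read `P = z₁∂₁P = z₂∂₂P = 0` on the torus;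
infinitely many solutions ⇒ infinitely many `z₁` (or `z₂`) coordinates ⇒ `P` is inseparable as a
polynomial in `z₂` over `ℂ(z₁)` ⇒ (Gauss) `G² ∣ P` for a primitive non-monomial `G` ⇒ for the outer
normal `ν` of an edge of `Newt(G)` the initial form `in_ν(P) = in_ν(G)²·in_ν(H)` is divisible by the
square of a non-monomial, impossible for the (at most) binomial `in_ν(P)` (a line meets the ellipse in
≤ 2 points; `a z^α + b z^β` and its derivation `z_i∂_i` span both monomials). Pure algebra, no
analysis; numerically confirmed on square/hex/rectangular/generic shells (card §Stubs). -/
theorem stub_critFinite :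
    ∀ (u s t : EuclideanSpace ℝ (Fin 3)), u ≠ 0 → inner ℝ s u = 0 → inner ℝ t u = 0 → t ≠ 0 →
      s ∉ Submodule.span ℝ ({t} : Set (EuclideanSpace ℝ (Fin 3))) →
      ∀ (Y : Finset (EuclideanSpace ℝ (Fin 3))) (y : EuclideanSpace ℝ (Fin 3) → ℂ) (ρ : ℝ),
        (∀ w ∈ Y, inner ℝ w u = 0 ∧ ‖w‖ = ρ ∧ (∃ m : ℤ, inner ℝ w s = (m : ℝ)) ∧
          (∃ m : ℤ, inner ℝ w t = (m : ℝ))) →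
        (∃ w ∈ Y, y w ≠ 0) →
        ∃ Z : Finset (EuclideanSpace ℝ (Fin 3)), ∀ b : EuclideanSpace ℝ (Fin 3), inner ℝ b u = 0 →
          (∑ w ∈ Y, y w * Complex.exp (2 * Real.pi * Complex.I * (inner ℝ w b : ℝ))) = 0 →
          (∑ w ∈ Y, y w * (inner ℝ w s : ℝ) *
              Complex.exp (2 * Real.pi * Complex.I * (inner ℝ w b : ℝ))) = 0 →
          (∑ w ∈ Y, y w * (inner ℝ w t : ℝ) *
              Complex.exp (2 * Real.pi * Complex.I * (inner ℝ w b : ℝ))) = 0 →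
          ∃ z ∈ Z, ∃ m₁ m₂ : ℤ, b = z + (m₁ : ℝ) • s + (m₂ : ℝ) • t := by
  sorry

/-- **LEADING-SHELL LOCKING, ANALYTIC HALF (the lever): a genuine defect confines the deep
registries ASYMPTOTICALLY to a finite set.** In the layered pair form (both sets `δ`-separated,
`r`-dense, FLC, in exact Lennard-Jones force balance, common independent horizontal periods
`s, t ⊥ u`, agreement on `{⟪z,u⟫ < a}`), if `ω ≠ ω'` then there is a FINITE set `N` such that for
every `ε > 0` all points of `ω` below some plane `{⟪z,u⟫ < a₁(ε)}` lie within `ε` of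
`N + ℤs + ℤt + ℝu`. Taken as hypotheses: the Duffin–Schaeffer theorem (zero-mode step off arithmetic
progressions: `norm_le_exp_of_exp_decay_on_relDense` + `ae_eq_zero_of_laplace_exp_decay` +
`eq_zero_of_generalDirichlet_hasSum_zero` ⇒ every defect layer is density-neutral) and the
critical-zero finiteness `stub_critFinite`. Route: the signed field vanishes at every observer
`x ∈ ω` below the plane (`hbl_diffField_eq_zero_on_halfSpace`); in the mode expansion
(`hbl_signedField_hasSum_modes`, p169784) every mode amplitude is a Laplace transform in the depth
carried by `[2π‖w_k‖, ∞)` (Bessel–Laplace kernel measures p163412, shell form p166376, vertical /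
horizontal profiles p168286 / p169505); a genuine defect has a first shell `ρ*` with a non-trivial
structure-factor Dirichlet series (`hbl_reps_layer_empty_of_structureFactors`, p167853, + Dirichlet
uniqueness), and by endpoint domination (p165799) all modes of that shell share ONE leading depth
profile, the others being `o` of it uniformly (tails `∑_η |ĉ_η| e^{-2πρ*η} η^m < ∞` from
`hbl_summable_reps_exp_neg_height`); dividing the observer equations by it, every accumulation
registry `b` of deep `ω`-points satisfies `T_y(b) = 0`, `∇T_y(b) = 0` for the non-zero one-shell
data `y_w = S_w^{(j)}(2πρ*)`; `stub_critFinite` makes that set finite mod `L`, and compactness of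
`W/L` turns "every accumulation registry lies in a finite set" into the `ε`–`a₁` statement. Why it
might fail: only through the Watson uniformity over defect layers. Implied by the crux (vacuous for
rigid pairs). -/
theorem stub_lockingLimit : Literature.Analysis.Complex.Boas1954_thm_10_5_1 →
    (∀ (u s t : EuclideanSpace ℝ (Fin 3)), u ≠ 0 → inner ℝ s u = 0 → inner ℝ t u = 0 → t ≠ 0 →
      s ∉ Submodule.span ℝ ({t} : Set (EuclideanSpace ℝ (Fin 3))) →
      ∀ (Y : Finset (EuclideanSpace ℝ (Fin 3))) (y : EuclideanSpace ℝ (Fin 3) → ℂ) (ρ : ℝ),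
        (∀ w ∈ Y, inner ℝ w u = 0 ∧ ‖w‖ = ρ ∧ (∃ m : ℤ, inner ℝ w s = (m : ℝ)) ∧
          (∃ m : ℤ, inner ℝ w t = (m : ℝ))) →
        (∃ w ∈ Y, y w ≠ 0) →
        ∃ Z : Finset (EuclideanSpace ℝ (Fin 3)), ∀ b : EuclideanSpace ℝ (Fin 3), inner ℝ b u = 0 →
          (∑ w ∈ Y, y w * Complex.exp (2 * Real.pi * Complex.I * (inner ℝ w b : ℝ))) = 0 →
          (∑ w ∈ Y, y w * (inner ℝ w s : ℝ) *
              Complex.exp (2 * Real.pi * Complex.I * (inner ℝ w b : ℝ))) = 0 →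
          (∑ w ∈ Y, y w * (inner ℝ w t : ℝ) *
              Complex.exp (2 * Real.pi * Complex.I * (inner ℝ w b : ℝ))) = 0 →
          ∃ z ∈ Z, ∃ m₁ m₂ : ℤ, b = z + (m₁ : ℝ) • s + (m₂ : ℝ) • t) →
    ∀ (ω ω' : Set (EuclideanSpace ℝ (Fin 3))) (δ r : ℝ), 0 < δ → 0 < r →
      (∀ x ∈ ω, ∀ y ∈ ω, x ≠ y → δ ≤ dist x y) →
      (∀ x ∈ ω', ∀ y ∈ ω', x ≠ y → δ ≤ dist x y) →
      (∀ c : EuclideanSpace ℝ (Fin 3), ∃ y ∈ ω, dist y c ≤ r) →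
      (∀ c : EuclideanSpace ℝ (Fin 3), ∃ y ∈ ω', dist y c ≤ r) →
      (∀ R : ℝ, Set.Finite {S : Set (EuclideanSpace ℝ (Fin 3)) |
        ∃ x ∈ ω, S = {v : EuclideanSpace ℝ (Fin 3) | x + v ∈ ω ∧ ‖v‖ ≤ R}}) →
      (∀ R : ℝ, Set.Finite {S : Set (EuclideanSpace ℝ (Fin 3)) |
        ∃ x ∈ ω', S = {v : EuclideanSpace ℝ (Fin 3) | x + v ∈ ω' ∧ ‖v‖ ≤ R}}) →
      (∀ x ∈ ω, HasSum (fun y : {y : EuclideanSpace ℝ (Fin 3) // y ∈ ω ∧ y ≠ x} =>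
        (deriv Literature.MathematicalPhysics.StatisticalMechanics.lennardJones
            (dist x (y : EuclideanSpace ℝ (Fin 3))) /
          dist x (y : EuclideanSpace ℝ (Fin 3))) • (x - (y : EuclideanSpace ℝ (Fin 3)))) 0) →
      (∀ x ∈ ω', HasSum (fun y : {y : EuclideanSpace ℝ (Fin 3) // y ∈ ω' ∧ y ≠ x} =>
        (deriv Literature.MathematicalPhysics.StatisticalMechanics.lennardJones
            (dist x (y : EuclideanSpace ℝ (Fin 3))) /
          dist x (y : EuclideanSpace ℝ (Fin 3))) • (x - (y : EuclideanSpace ℝ (Fin 3)))) 0) →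
      ∀ s t : EuclideanSpace ℝ (Fin 3), t ≠ 0 →
        s ∉ Submodule.span ℝ ({t} : Set (EuclideanSpace ℝ (Fin 3))) →
        (∀ x : EuclideanSpace ℝ (Fin 3), x + t ∈ ω ↔ x ∈ ω) → (∀ x : EuclideanSpace ℝ (Fin 3), x + s ∈ ω ↔ x ∈ ω) →
        (∀ x : EuclideanSpace ℝ (Fin 3), x + t ∈ ω' ↔ x ∈ ω') → (∀ x : EuclideanSpace ℝ (Fin 3), x + s ∈ ω' ↔ x ∈ ω') →
      ∀ (u : EuclideanSpace ℝ (Fin 3)) (a : ℝ), u ≠ 0 → inner ℝ s u = 0 → inner ℝ t u = 0 →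
      (∀ z : EuclideanSpace ℝ (Fin 3), inner ℝ z u < a → (z ∈ ω ↔ z ∈ ω')) →
      ω ≠ ω' →
      ∃ N : Finset (EuclideanSpace ℝ (Fin 3)), ∀ ε : ℝ, 0 < ε → ∃ a₁ : ℝ,
        ∀ x ∈ ω, inner ℝ x u < a₁ →
          ∃ n ∈ N, ∃ m₁ m₂ : ℤ, ∃ τ : ℝ, dist x (n + (m₁ : ℝ) • s + (m₂ : ℝ) • t + τ • u) < ε := by
  sorry

/-- **EXACT CONFINEMENT FROM ASYMPTOTIC CONFINEMENT (FLC + Delone, one configuration).** Let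
`ω ⊂ ℝ³` be `δ`-separated, `r`-dense and FLC, `u ≠ 0`, and `s, t ⊥ u` independent. If the points of
`ω` deep below are asymptotically confined to `N + ℤs + ℤt + ℝu` for a FINITE `N` (for every `ε > 0`,
below some plane every point is within `ε` of it), then below some plane every point of `ω` lies
EXACTLY in `S + ℤs + ℤt + ℝu` for a finite `S`. Proof route: FLC ⇒ the neighbour steps
`Δ = {x − y : x, y ∈ ω, ‖x − y‖ ≤ 2r + 1}` form a finite set; `P(N) + L` and `PΔ − (P(N) − P(N)) + L`
(`P` = projection along `u` onto `W`, `L = ℤs + ℤt`) are finite unions of `L`-cosets, hence uniformly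
discrete (`η > 0`); for `ε < η/4` the error `e(x) = Px − n(x)` (`n(x)` = nearest point of `P(N)+L`)
of two deep points at distance `≤ 2r+1` differs by an element of a uniformly discrete set of norm
`< η/2`, hence by `0`; `r`-density makes the deep region `(2r+1)`-chain-connected, so `e ≡ e₀` is
constant there and every deep registry lies in `P(N) + e₀ + L`: `S = N + e₀`. No analysis. -/
theorem stub_confinement :
    ∀ (ω : Set (EuclideanSpace ℝ (Fin 3))) (δ r : ℝ), 0 < δ → 0 < r →
      (∀ x ∈ ω, ∀ y ∈ ω, x ≠ y → δ ≤ dist x y) →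
      (∀ c : EuclideanSpace ℝ (Fin 3), ∃ y ∈ ω, dist y c ≤ r) →
      (∀ R : ℝ, Set.Finite {S : Set (EuclideanSpace ℝ (Fin 3)) |
        ∃ x ∈ ω, S = {v : EuclideanSpace ℝ (Fin 3) | x + v ∈ ω ∧ ‖v‖ ≤ R}}) →
      ∀ s t u : EuclideanSpace ℝ (Fin 3), u ≠ 0 → t ≠ 0 →
        s ∉ Submodule.span ℝ ({t} : Set (EuclideanSpace ℝ (Fin 3))) →
        inner ℝ s u = 0 → inner ℝ t u = 0 →
      ∀ N : Finset (EuclideanSpace ℝ (Fin 3)),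
        (∀ ε : ℝ, 0 < ε → ∃ a₁ : ℝ, ∀ x ∈ ω, inner ℝ x u < a₁ →
          ∃ n ∈ N, ∃ m₁ m₂ : ℤ, ∃ τ : ℝ, dist x (n + (m₁ : ℝ) • s + (m₂ : ℝ) • t + τ • u) < ε) →
      ∃ a' : ℝ, ∃ S : Finset (EuclideanSpace ℝ (Fin 3)),
        ∀ x ∈ ω, inner ℝ x u < a' →
          ∃ b ∈ S, ∃ m₁ m₂ : ℤ, ∃ τ : ℝ, x = b + (m₁ : ℝ) • s + (m₂ : ℝ) • t + τ • u := by
  sorry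

/-! ## Leading-shell locking (sorry-free from the three stubs above) -/

/-- **LEADING-SHELL LOCKING (the lever)** ⇐ `stub_lockingLimit` (fed with the Duffin–Schaeffer
hypothesis and `stub_critFinite`) + `stub_confinement`: in the layered pair form a GENUINE defect
(`ω ≠ ω'`) CONFINES the deep registries of `ω` EXACTLY — below some plane every point of `ω` is
`b + m₁ s + m₂ t + τ u` with `b` from a finite set. -/
theorem shellLocking : Literature.Analysis.Complex.Boas1954_thm_10_5_1 →
    ∀ (ω ω' : Set (EuclideanSpace ℝ (Fin 3))) (δ r : ℝ), 0 < δ → 0 < r →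
      (∀ x ∈ ω, ∀ y ∈ ω, x ≠ y → δ ≤ dist x y) →
      (∀ x ∈ ω', ∀ y ∈ ω', x ≠ y → δ ≤ dist x y) →
      (∀ c : EuclideanSpace ℝ (Fin 3), ∃ y ∈ ω, dist y c ≤ r) →
      (∀ c : EuclideanSpace ℝ (Fin 3), ∃ y ∈ ω', dist y c ≤ r) →
      (∀ R : ℝ, Set.Finite {S : Set (EuclideanSpace ℝ (Fin 3)) |
        ∃ x ∈ ω, S = {v : EuclideanSpace ℝ (Fin 3) | x + v ∈ ω ∧ ‖v‖ ≤ R}}) →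
      (∀ R : ℝ, Set.Finite {S : Set (EuclideanSpace ℝ (Fin 3)) |
        ∃ x ∈ ω', S = {v : EuclideanSpace ℝ (Fin 3) | x + v ∈ ω' ∧ ‖v‖ ≤ R}}) →
      (∀ x ∈ ω, HasSum (fun y : {y : EuclideanSpace ℝ (Fin 3) // y ∈ ω ∧ y ≠ x} =>
        (deriv Literature.MathematicalPhysics.StatisticalMechanics.lennardJones
            (dist x (y : EuclideanSpace ℝ (Fin 3))) /
          dist x (y : EuclideanSpace ℝ (Fin 3))) • (x - (y : EuclideanSpace ℝ (Fin 3)))) 0) →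
      (∀ x ∈ ω', HasSum (fun y : {y : EuclideanSpace ℝ (Fin 3) // y ∈ ω' ∧ y ≠ x} =>
        (deriv Literature.MathematicalPhysics.StatisticalMechanics.lennardJones
            (dist x (y : EuclideanSpace ℝ (Fin 3))) /
          dist x (y : EuclideanSpace ℝ (Fin 3))) • (x - (y : EuclideanSpace ℝ (Fin 3)))) 0) →
      ∀ s t : EuclideanSpace ℝ (Fin 3), t ≠ 0 →
        s ∉ Submodule.span ℝ ({t} : Set (EuclideanSpace ℝ (Fin 3))) →
        (∀ x : EuclideanSpace ℝ (Fin 3), x + t ∈ ω ↔ x ∈ ω) → (∀ x : EuclideanSpace ℝ (Fin 3), x + s ∈ ω ↔ x ∈ ω) →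
        (∀ x : EuclideanSpace ℝ (Fin 3), x + t ∈ ω' ↔ x ∈ ω') → (∀ x : EuclideanSpace ℝ (Fin 3), x + s ∈ ω' ↔ x ∈ ω') →
      ∀ (u : EuclideanSpace ℝ (Fin 3)) (a : ℝ), u ≠ 0 → inner ℝ s u = 0 → inner ℝ t u = 0 →
      (∀ z : EuclideanSpace ℝ (Fin 3), inner ℝ z u < a → (z ∈ ω ↔ z ∈ ω')) →
      ω ≠ ω' →
      ∃ a' : ℝ, ∃ S : Finset (EuclideanSpace ℝ (Fin 3)),
        ∀ x ∈ ω, inner ℝ x u < a' →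
          ∃ b ∈ S, ∃ m₁ m₂ : ℤ, ∃ τ : ℝ, x = b + (m₁ : ℝ) • s + (m₂ : ℝ) • t + τ • u := by
  intro hDS ω ω' δ r hδ hr hsep hsep' hden hden' hFLC hFLC' hbal hbal' s t ht0 hs hωt hωs hω't hω's u a
    hu hsu htu hagree hne
  obtain ⟨N, hN⟩ := stub_lockingLimit hDS stub_critFinite ω ω' δ r hδ hr hsep hsep' hden hden' hFLC
    hFLC' hbal hbal' s t ht0 hs hωt hωs hω't hω's u a hu hsu htu hagree hne
  exact stub_confinement ω δ r hδ hr hsep hden hFLC s t u hu ht0 hs hsu htu N hN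

/-- **CONFINED LAYERED PAIRS ARE RIGID (every layer lattice).** In the layered pair form, if below
some plane the registries of `ω` modulo `ℤs + ℤt` form a finite set, then `ω = ω'`. For a GENERIC
layer lattice this is c3's `hbl_layered_eq_of_finite_registries` with the agreement plane lowered to
`min a a'` (a registry class of positive upper density is a thick column; `hbl_thickColumn_rigidity'`);
for the four SPECIAL families (square, hexagonal, rectangular, centred-rectangular) the per-fibre
shell equations `∑_{k∈S} e_k(b)(1, w_k) ĉ_η(k) = 0` from the finitely many thick classes `b` leave
exactly the point-group-antisymmetric (Wyckoff-twin) defect fibres, to be excluded by full force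
balance at the defect points — the residual of the line. Why it might fail: a balanced Wyckoff-twin
pair over a square or hexagonal layer lattice (disprover target; none is known, and a pair of FLC
balanced sets would refute `FLCEquilibriumPeriodic` itself). -/
theorem stub_confinedRigidity :
    ∀ (ω ω' : Set (EuclideanSpace ℝ (Fin 3))) (δ r : ℝ), 0 < δ → 0 < r →
      (∀ x ∈ ω, ∀ y ∈ ω, x ≠ y → δ ≤ dist x y) →
      (∀ x ∈ ω', ∀ y ∈ ω', x ≠ y → δ ≤ dist x y) →
      (∀ c : EuclideanSpace ℝ (Fin 3), ∃ y ∈ ω, dist y c ≤ r) →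
      (∀ c : EuclideanSpace ℝ (Fin 3), ∃ y ∈ ω', dist y c ≤ r) →
      (∀ R : ℝ, Set.Finite {S : Set (EuclideanSpace ℝ (Fin 3)) |
        ∃ x ∈ ω, S = {v : EuclideanSpace ℝ (Fin 3) | x + v ∈ ω ∧ ‖v‖ ≤ R}}) →
      (∀ R : ℝ, Set.Finite {S : Set (EuclideanSpace ℝ (Fin 3)) |
        ∃ x ∈ ω', S = {v : EuclideanSpace ℝ (Fin 3) | x + v ∈ ω' ∧ ‖v‖ ≤ R}}) →
      (∀ x ∈ ω, HasSum (fun y : {y : EuclideanSpace ℝ (Fin 3) // y ∈ ω ∧ y ≠ x} =>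
        (deriv Literature.MathematicalPhysics.StatisticalMechanics.lennardJones
            (dist x (y : EuclideanSpace ℝ (Fin 3))) /
          dist x (y : EuclideanSpace ℝ (Fin 3))) • (x - (y : EuclideanSpace ℝ (Fin 3)))) 0) →
      (∀ x ∈ ω', HasSum (fun y : {y : EuclideanSpace ℝ (Fin 3) // y ∈ ω' ∧ y ≠ x} =>
        (deriv Literature.MathematicalPhysics.StatisticalMechanics.lennardJones
            (dist x (y : EuclideanSpace ℝ (Fin 3))) /
          dist x (y : EuclideanSpace ℝ (Fin 3))) • (x - (y : EuclideanSpace ℝ (Fin 3)))) 0) →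
      ∀ s t : EuclideanSpace ℝ (Fin 3), t ≠ 0 →
        s ∉ Submodule.span ℝ ({t} : Set (EuclideanSpace ℝ (Fin 3))) →
        (∀ x : EuclideanSpace ℝ (Fin 3), x + t ∈ ω ↔ x ∈ ω) → (∀ x : EuclideanSpace ℝ (Fin 3), x + s ∈ ω ↔ x ∈ ω) →
        (∀ x : EuclideanSpace ℝ (Fin 3), x + t ∈ ω' ↔ x ∈ ω') → (∀ x : EuclideanSpace ℝ (Fin 3), x + s ∈ ω' ↔ x ∈ ω') →
      ∀ (u : EuclideanSpace ℝ (Fin 3)) (a : ℝ), u ≠ 0 → inner ℝ s u = 0 → inner ℝ t u = 0 →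
      (∀ z : EuclideanSpace ℝ (Fin 3), inner ℝ z u < a → (z ∈ ω ↔ z ∈ ω')) →
      ∀ (a' : ℝ) (S : Finset (EuclideanSpace ℝ (Fin 3))),
        (∀ x ∈ ω, inner ℝ x u < a' →
          ∃ b ∈ S, ∃ m₁ m₂ : ℤ, ∃ τ : ℝ, x = b + (m₁ : ℝ) • s + (m₂ : ℝ) • t + τ • u) →
      ω = ω' := by
  sorry

/-! ## The layered core in pair form, and the cores of rank 1 and 2 (sorry-free) -/

/-- **Layered pairs are rigid** ⇐ `stub_shellLocking` (with `stub_duffinSchaeffer`) +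
`stub_confinedRigidity`: a genuine defect would confine the deep registries, and confined pairs are
rigid. -/
theorem layeredRigidity :
    ∀ (ω ω' : Set (EuclideanSpace ℝ (Fin 3))) (δ r : ℝ), 0 < δ → 0 < r →
      (∀ x ∈ ω, ∀ y ∈ ω, x ≠ y → δ ≤ dist x y) →
      (∀ x ∈ ω', ∀ y ∈ ω', x ≠ y → δ ≤ dist x y) →
      (∀ c : EuclideanSpace ℝ (Fin 3), ∃ y ∈ ω, dist y c ≤ r) →
      (∀ c : EuclideanSpace ℝ (Fin 3), ∃ y ∈ ω', dist y c ≤ r) →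
      (∀ R : ℝ, Set.Finite {S : Set (EuclideanSpace ℝ (Fin 3)) |
        ∃ x ∈ ω, S = {v : EuclideanSpace ℝ (Fin 3) | x + v ∈ ω ∧ ‖v‖ ≤ R}}) →
      (∀ R : ℝ, Set.Finite {S : Set (EuclideanSpace ℝ (Fin 3)) |
        ∃ x ∈ ω', S = {v : EuclideanSpace ℝ (Fin 3) | x + v ∈ ω' ∧ ‖v‖ ≤ R}}) →
      (∀ x ∈ ω, HasSum (fun y : {y : EuclideanSpace ℝ (Fin 3) // y ∈ ω ∧ y ≠ x} =>
        (deriv Literature.MathematicalPhysics.StatisticalMechanics.lennardJones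
            (dist x (y : EuclideanSpace ℝ (Fin 3))) /
          dist x (y : EuclideanSpace ℝ (Fin 3))) • (x - (y : EuclideanSpace ℝ (Fin 3)))) 0) →
      (∀ x ∈ ω', HasSum (fun y : {y : EuclideanSpace ℝ (Fin 3) // y ∈ ω' ∧ y ≠ x} =>
        (deriv Literature.MathematicalPhysics.StatisticalMechanics.lennardJones
            (dist x (y : EuclideanSpace ℝ (Fin 3))) /
          dist x (y : EuclideanSpace ℝ (Fin 3))) • (x - (y : EuclideanSpace ℝ (Fin 3)))) 0) →
      ∀ s t : EuclideanSpace ℝ (Fin 3), t ≠ 0 →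
        s ∉ Submodule.span ℝ ({t} : Set (EuclideanSpace ℝ (Fin 3))) →
        (∀ x : EuclideanSpace ℝ (Fin 3), x + t ∈ ω ↔ x ∈ ω) → (∀ x : EuclideanSpace ℝ (Fin 3), x + s ∈ ω ↔ x ∈ ω) →
        (∀ x : EuclideanSpace ℝ (Fin 3), x + t ∈ ω' ↔ x ∈ ω') → (∀ x : EuclideanSpace ℝ (Fin 3), x + s ∈ ω' ↔ x ∈ ω') →
      ∀ (u : EuclideanSpace ℝ (Fin 3)) (a : ℝ), u ≠ 0 → inner ℝ s u = 0 → inner ℝ t u = 0 →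
      (∀ z : EuclideanSpace ℝ (Fin 3), inner ℝ z u < a → (z ∈ ω ↔ z ∈ ω')) → ω = ω' := by
  intro ω ω' δ r hδ hr hsep hsep' hden hden' hFLC hFLC' hbal hbal' s t ht0 hs hωt hωs hω't hω's u a hu
    hsu htu hagree
  by_contra hne
  obtain ⟨a', S, hS⟩ := shellLocking stub_duffinSchaeffer ω ω' δ r hδ hr hsep hsep' hden hden'
    hFLC hFLC' hbal hbal' s t ht0 hs hωt hωs hω't hω's u a hu hsu htu hagree hne
  exact hne (stub_confinedRigidity ω ω' δ r hδ hr hsep hsep' hden hden' hFLC hFLC' hbal hbal' s t ht0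
    hs hωt hωs hω't hω's u a hu hsu htu hagree a' S hS)

/-- **core₁ from `stub_rodOpenVanishing`** (as in line `birth`): hull transfer + `UCContinuum`. -/
theorem ucRank1 :
    ∀ (Λ : Set (EuclideanSpace ℝ (Fin 3))) (δ r : ℝ), 0 < δ → 0 < r →
      (∀ x ∈ Λ, ∀ y ∈ Λ, x ≠ y → δ ≤ dist x y) →
      (∀ c : EuclideanSpace ℝ (Fin 3), ∃ y ∈ Λ, dist y c ≤ r) →
      (∀ R : ℝ, Set.Finite {S : Set (EuclideanSpace ℝ (Fin 3)) |
        ∃ x ∈ Λ, S = {v : EuclideanSpace ℝ (Fin 3) | x + v ∈ Λ ∧ ‖v‖ ≤ R}}) →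
      (∀ x ∈ Λ, HasSum (fun y : {y : EuclideanSpace ℝ (Fin 3) // y ∈ Λ ∧ y ≠ x} =>
        (deriv Literature.MathematicalPhysics.StatisticalMechanics.lennardJones
            (dist x (y : EuclideanSpace ℝ (Fin 3))) /
          dist x (y : EuclideanSpace ℝ (Fin 3))) • (x - (y : EuclideanSpace ℝ (Fin 3)))) 0) →
      ∀ t : EuclideanSpace ℝ (Fin 3), t ≠ 0 →
        (∀ x : EuclideanSpace ℝ (Fin 3), x + t ∈ Λ ↔ x ∈ Λ) →
        (∀ s : EuclideanSpace ℝ (Fin 3), (∀ x : EuclideanSpace ℝ (Fin 3), x + s ∈ Λ ↔ x ∈ Λ) →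
          s ∈ Submodule.span ℝ ({t} : Set (EuclideanSpace ℝ (Fin 3)))) →
      ∀ ω ω' : Set (EuclideanSpace ℝ (Fin 3)),
        (∀ R : ℝ, ∃ v : EuclideanSpace ℝ (Fin 3),
          {z : EuclideanSpace ℝ (Fin 3) | z ∈ ω ∧ ‖z‖ ≤ R} =
            {z : EuclideanSpace ℝ (Fin 3) | z + v ∈ Λ ∧ ‖z‖ ≤ R}) →
        (∀ R : ℝ, ∃ v : EuclideanSpace ℝ (Fin 3),
          {z : EuclideanSpace ℝ (Fin 3) | z ∈ ω' ∧ ‖z‖ ≤ R} =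
            {z : EuclideanSpace ℝ (Fin 3) | z + v ∈ Λ ∧ ‖z‖ ≤ R}) →
        ∀ (u : EuclideanSpace ℝ (Fin 3)) (a : ℝ), u ≠ 0 → inner ℝ t u = 0 →
          (∀ z : EuclideanSpace ℝ (Fin 3), inner ℝ z u < a → (z ∈ ω ↔ z ∈ ω')) → ω = ω'  := by
  intro Λ δ r hδ hr hsep hden hFLC hbal t ht0 ht _ ω ω' hω hω' u a hu htu hagree
  obtain ⟨U₀, hU₀, hne, hUhalf, hΦ⟩ := stub_rodOpenVanishing ω ω' δ r hδ hr
    (hbl_hull_separated hsep hω) (hbl_hull_separated hsep hω') (hbl_hull_dense hden hω)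
    (hbl_hull_dense hden hω') (hbl_hull_flc hFLC hω) (hbl_hull_flc hFLC hω')
    (hbl_hull_balanced hδ hsep hbal hω) (hbl_hull_balanced hδ hsep hbal hω') t ht0
    (hbl_hull_period ht hω) (hbl_hull_period ht hω') u a hu htu hagree
  refine hbl_eq_of_diffField_eqOn_open hδ (hbl_hull_separated hsep hω) (hbl_hull_separated hsep hω')
    hU₀ hne ?_ ?_ hΦ
  · rintro z hz ⟨hzω, hzω'⟩
    exact hzω' ((hagree z (hUhalf z hz)).1 hzω)
  · rintro z hz ⟨hzω', hzω⟩
    exact hzω ((hagree z (hUhalf z hz)).2 hzω')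

/-- **core₂ from `layeredRigidity`**: transfer separation, density, FLC, balance and both periods
from `Λ` to the hull elements and apply the pair-form rigidity. -/
theorem ucRank2 :
    ∀ (Λ : Set (EuclideanSpace ℝ (Fin 3))) (δ r : ℝ), 0 < δ → 0 < r →
      (∀ x ∈ Λ, ∀ y ∈ Λ, x ≠ y → δ ≤ dist x y) →
      (∀ c : EuclideanSpace ℝ (Fin 3), ∃ y ∈ Λ, dist y c ≤ r) →
      (∀ R : ℝ, Set.Finite {S : Set (EuclideanSpace ℝ (Fin 3)) |
        ∃ x ∈ Λ, S = {v : EuclideanSpace ℝ (Fin 3) | x + v ∈ Λ ∧ ‖v‖ ≤ R}}) →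
      (∀ x ∈ Λ, HasSum (fun y : {y : EuclideanSpace ℝ (Fin 3) // y ∈ Λ ∧ y ≠ x} =>
        (deriv Literature.MathematicalPhysics.StatisticalMechanics.lennardJones
            (dist x (y : EuclideanSpace ℝ (Fin 3))) /
          dist x (y : EuclideanSpace ℝ (Fin 3))) • (x - (y : EuclideanSpace ℝ (Fin 3)))) 0) →
      ∀ s t : EuclideanSpace ℝ (Fin 3), t ≠ 0 →
        s ∉ Submodule.span ℝ ({t} : Set (EuclideanSpace ℝ (Fin 3))) →
        (∀ x : EuclideanSpace ℝ (Fin 3), x + t ∈ Λ ↔ x ∈ Λ) →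
        (∀ x : EuclideanSpace ℝ (Fin 3), x + s ∈ Λ ↔ x ∈ Λ) →
        (∀ w : EuclideanSpace ℝ (Fin 3), (∀ x : EuclideanSpace ℝ (Fin 3), x + w ∈ Λ ↔ x ∈ Λ) →
          w ∈ Submodule.span ℝ ({s, t} : Set (EuclideanSpace ℝ (Fin 3)))) →
      ∀ ω ω' : Set (EuclideanSpace ℝ (Fin 3)),
        (∀ R : ℝ, ∃ v : EuclideanSpace ℝ (Fin 3),
          {z : EuclideanSpace ℝ (Fin 3) | z ∈ ω ∧ ‖z‖ ≤ R} =
            {z : EuclideanSpace ℝ (Fin 3) | z + v ∈ Λ ∧ ‖z‖ ≤ R}) →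
        (∀ R : ℝ, ∃ v : EuclideanSpace ℝ (Fin 3),
          {z : EuclideanSpace ℝ (Fin 3) | z ∈ ω' ∧ ‖z‖ ≤ R} =
            {z : EuclideanSpace ℝ (Fin 3) | z + v ∈ Λ ∧ ‖z‖ ≤ R}) →
        ∀ (u : EuclideanSpace ℝ (Fin 3)) (a : ℝ), u ≠ 0 → inner ℝ s u = 0 → inner ℝ t u = 0 →
          (∀ z : EuclideanSpace ℝ (Fin 3), inner ℝ z u < a → (z ∈ ω ↔ z ∈ ω')) → ω = ω'  := by
  intro Λ δ r hδ hr hsep hden hFLC hbal s t ht0 hs ht hsper _ ω ω' hω hω' u a hu hsu htu hagree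
  exact layeredRigidity ω ω' δ r hδ hr
    (hbl_hull_separated hsep hω) (hbl_hull_separated hsep hω') (hbl_hull_dense hden hω)
    (hbl_hull_dense hden hω') (hbl_hull_flc hFLC hω) (hbl_hull_flc hFLC hω')
    (hbl_hull_balanced hδ hsep hbal hω) (hbl_hull_balanced hδ hsep hbal hω') s t ht0 hs
    (hbl_hull_period ht hω) (hbl_hull_period hsper hω) (hbl_hull_period ht hω')
    (hbl_hull_period hsper hω') u a hu hsu htu hagree

/-! ## The skeleton theorem -/

/-- **The crux BY NAME from the registered stubs**: the landed ladder `stub_rungsOfCores` turns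
core₀ (`stub_ucRank0`), core₁ (`ucRank1` ⇐ `stub_rodOpenVanishing`), core₂ (`ucRank2` ⇐
`stub_shellLocking` + `stub_duffinSchaeffer` + `stub_confinedRigidity`) into `FLCEquilibriumPeriodic`,
and the landed converse glue `halfSpaceUniqueContinuation_of_flcEquilibriumPeriodic` gives
`HalfSpaceUniqueContinuation`. -/
theorem HalfSpaceUniqueContinuation_of : HalfSpaceUniqueContinuation :=
  halfSpaceUniqueContinuation_of_flcEquilibriumPeriodic
    (Summit.AtomisticToContinuum.Crystallization.Theorems.HolmgrenBoyleLind.stub_rungsOfCores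
      stub_ucRank0 ucRank1 ucRank2)

end Summit.AtomisticToContinuum.Crystallization.Cruxes.HalfSpaceUniqueContinuation.ShellLocking
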